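import Literature.NumberTheory.LFunctions.GeneralizedBernoulliGeneratingFunction
import Mathlib.NumberTheory.DirichletCharacter.GaussSum
import Mathlib.RingTheory.PowerSeries.Derivative
import HarnessLib

/-!
# Generalized Bernoulli numbers as Γ-transforms of a rational function

Topic `Literature/NumberTheory/LFunctions`; namespace `Literature.NumberTheory.LFunctions`.
THEOREMS ONLY (auxiliary `def`s with bodies; no named facts).

Let `λ` be a Dirichlet character modulo `f`, `φ` a PRIMITIVE Dirichlet character modulo `m₂` with
`m₂ ∤ f`, `ζ` a primitive `m₂`-th root of unity and `g(φ) = ∑_a φ(a) ζ^a` its Gauss sum, all with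
values in a field `K` of characteristic `0`.  For the product character `Λ = λ φ̄` modulo `f m₂` and
`n ≥ 1` we prove the classical identity behind Washington's theorem
(`gaussSum_mul_generalizedBernoulli`):

  `g(φ) · B_{n,Λ} = n · ∑_{b ∈ (ℤ/m₂)ˣ} φ(b) · Q_{n-1}(ζ^b) / ((ζ^b)^f - 1)^n`,

where `Q_k ∈ K[Z]` are the numerators of `(Z d/dZ)^k [∑_{c<f} λ(c) Z^c / (Z^f - 1)]`
(`qpoly`; `Q_0 = ∑_{c<f} λ(c) Z^c`, `Q_{k+1} = (Z^f-1)·Z Q_k' - (k+1)·Q_k·Z (Z^f-1)'`).  This is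
Sinnott's Proposition 4.6 / (4.2) (the case `n = 1`, `L(0, θψ)`), obtained for all `n` by applying
`(d/dt)^{n-1}|_{t=0}` to the generating function `∑_k B_{k,Λ} t^k/k! = ∑_c Λ(c) t e^{ct}/(e^{mt}-1)`
(Diamond–Shurman (4.29), the tree's `genBernoulliSeries_mul_exp_sub_one`) after Gauss-sum
inversion `φ̄(c) g(φ) = ∑_b φ(b) ζ^{bc}` (Mathlib's `gaussSum_mulShift_of_isPrimitive`); all the
calculus is formal, in `K⟦t⟧` with Mathlib's `PowerSeries.derivative`.

The polynomial identities for `Q_k` needed to feed Sinnott's Theorem 3.2 (support on units,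
reflection `Z ↦ Z⁻¹`, a coefficient `±1`) are proved where they are used (the Washington–Sinnott
file); this file only does the calculus and the Gauss-sum bookkeeping.

## References

* W. Sinnott, *On a theorem of L. Washington*, Astérisque 147–148 (1987), 209–224, §4,
  Proposition 4.6 and (4.2). [Sinnott1987]
* F. Diamond, J. Shurman, *A First Course in Modular Forms*, GTM 228 (2005), §4.7 (4.29).
  [DiamondShurman2005]
* L. C. Washington, *Introduction to Cyclotomic Fields*, 2nd ed., GTM 83 (1997), §4.1, Lemma 4.7
  (Gauss sums of primitive characters). [Washington1997]
-/

noncomputable section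

open Finset PowerSeries

namespace Literature.NumberTheory.LFunctions

/-! ### The numerator polynomials `Q_k` -/

section QPoly

variable {K : Type*} [CommRing K]

/-- The numerators `Q_k` of `(Z d/dZ)^k [ (∑_{c<f} a(c) Z^c) / (Z^f - 1) ] = Q_k / (Z^f-1)^{k+1}`:
`Q_0 = ∑_{c<f} a(c) Z^c`, `Q_{k+1} = (Z^f - 1)(Q_k' Z) - (k+1) Q_k ((Z^f-1)' Z)`.
[cite: Sinnott1987, Prop. 4.6 (`R(Z)`, the case `k = 0`)] -/
def qpoly (a : ℕ → K) (f : ℕ) : ℕ → Polynomial K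
  | 0 => ∑ c ∈ range f, Polynomial.C (a c) * Polynomial.X ^ c
  | k + 1 => (Polynomial.X ^ f - 1) * (Polynomial.derivative (qpoly a f k) * Polynomial.X) -
      ((k + 1 : ℕ) : Polynomial K) *
        (qpoly a f k * (Polynomial.derivative (Polynomial.X ^ f - 1 : Polynomial K) * Polynomial.X))

/-- Unfolding `Q_0`. [folklore] -/
theorem qpoly_zero (a : ℕ → K) (f : ℕ) :
    qpoly a f 0 = ∑ c ∈ range f, Polynomial.C (a c) * Polynomial.X ^ c := rfl

/-- Unfolding `Q_{k+1}`. [folklore] -/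
theorem qpoly_succ (a : ℕ → K) (f k : ℕ) :
    qpoly a f (k + 1) = (Polynomial.X ^ f - 1) * (Polynomial.derivative (qpoly a f k) * Polynomial.X) -
      ((k + 1 : ℕ) : Polynomial K) *
        (qpoly a f k * (Polynomial.derivative (Polynomial.X ^ f - 1 : Polynomial K) * Polynomial.X)) :=
  rfl

/-- `Q_k` commutes with ring homomorphisms. [folklore] -/
theorem qpoly_map {L : Type*} [CommRing L] (σ : K →+* L) (a : ℕ → K) (f k : ℕ) :
    (qpoly a f k).map σ = qpoly (fun c ↦ σ (a c)) f k := by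
  induction k with
  | zero => simp [qpoly_zero, Polynomial.map_sum]
  | succ k ih =>
    simp only [qpoly_succ, Polynomial.map_sub, Polynomial.map_mul, Polynomial.map_pow, Polynomial.map_X,
      Polynomial.map_one, ← Polynomial.derivative_map, ih, Polynomial.map_natCast]

/-- `(X^f - 1)' X = f X^f` for `f ≥ 1`. [folklore] -/
theorem derivative_X_pow_sub_one_mul_X {f : ℕ} (hf : 1 ≤ f) :
    Polynomial.derivative (Polynomial.X ^ f - 1 : Polynomial K) * Polynomial.X =
      (f : Polynomial K) * Polynomial.X ^ f := by
  rw [Polynomial.derivative_sub, Polynomial.derivative_one, sub_zero, Polynomial.derivative_X_pow,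
    mul_assoc, ← pow_succ, Nat.sub_add_cancel hf, Polynomial.C_eq_natCast]

/-- The recursion with `(X^f-1)' X` evaluated: `Q_{k+1} = (X^f-1) Q_k' X - (k+1) f X^f Q_k`.
[folklore] -/
theorem qpoly_succ' (a : ℕ → K) {f : ℕ} (hf : 1 ≤ f) (k : ℕ) :
    qpoly a f (k + 1) = (Polynomial.X ^ f - 1) * (Polynomial.derivative (qpoly a f k) * Polynomial.X) -
      ((k + 1 : ℕ) : Polynomial K) * (f : Polynomial K) * Polynomial.X ^ f * qpoly a f k := by
  rw [qpoly_succ, derivative_X_pow_sub_one_mul_X hf]; ring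

/-- `deg Q_k ≤ f(k+1)`. [folklore] -/
theorem natDegree_qpoly_le (a : ℕ → K) {f : ℕ} (hf : 1 ≤ f) (k : ℕ) :
    (qpoly a f k).natDegree ≤ f * (k + 1) := by
  induction k with
  | zero =>
    rw [qpoly_zero, zero_add, mul_one]
    refine Polynomial.natDegree_sum_le_of_forall_le _ _ fun c hc ↦ ?_
    exact (Polynomial.natDegree_C_mul_X_pow_le _ _).trans (mem_range.mp hc).le
  | succ k ih =>
    rw [qpoly_succ' a hf]
    have hX : (Polynomial.X ^ f - 1 : Polynomial K).natDegree ≤ f :=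
      (Polynomial.natDegree_sub_le _ _).trans (max_le (Polynomial.natDegree_X_pow_le f) (by simp))
    have h1 : ((Polynomial.X ^ f - 1) * (Polynomial.derivative (qpoly a f k) * Polynomial.X)).natDegree ≤
        f * (k + 1 + 1) := by
      refine (Polynomial.natDegree_mul_le).trans ?_
      have := Polynomial.natDegree_mul_le (p := Polynomial.derivative (qpoly a f k)) (q := Polynomial.X)
      have hd := (Polynomial.natDegree_derivative_le (qpoly a f k)).trans (Nat.sub_le_sub_right ih 1)
      have hXd : (Polynomial.X : Polynomial K).natDegree ≤ 1 := Polynomial.natDegree_X_le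
      have : (Polynomial.derivative (qpoly a f k) * Polynomial.X).natDegree ≤ f * (k + 1) := by
        rcases Nat.eq_zero_or_pos (f * (k + 1)) with h0 | hpos
        · have : qpoly a f k = Polynomial.C ((qpoly a f k).coeff 0) :=
            Polynomial.eq_C_of_natDegree_le_zero (by omega)
          rw [this, Polynomial.derivative_C, zero_mul, Polynomial.natDegree_zero]; exact Nat.zero_le _
        · exact this.trans (by omega)
      calc _ ≤ f + f * (k + 1) := Nat.add_le_add hX this
        _ = f * (k + 1 + 1) := by ring
    have h2 : (((k + 1 : ℕ) : Polynomial K) * (f : Polynomial K) * Polynomial.X ^ f * qpoly a f k).natDegree ≤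
        f * (k + 1 + 1) := by
      refine (Polynomial.natDegree_mul_le).trans ?_
      have h3 : (((k + 1 : ℕ) : Polynomial K) * (f : Polynomial K) * Polynomial.X ^ f).natDegree ≤ f := by
        refine (Polynomial.natDegree_mul_le).trans ?_
        have h4 : (((k + 1 : ℕ) : Polynomial K) * (f : Polynomial K)).natDegree ≤ 0 := by
          rw [← Nat.cast_mul]; exact (Polynomial.natDegree_natCast _).le
        have h5 : (Polynomial.X ^ f : Polynomial K).natDegree ≤ f := Polynomial.natDegree_X_pow_le f
        omega
      calc _ ≤ f + f * (k + 1) := Nat.add_le_add h3 ih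
        _ = f * (k + 1 + 1) := by ring
    exact (Polynomial.natDegree_sub_le _ _).trans (max_le h1 h2)

/-- `Q_k(0) = 0` when `a(0) = 0`. [folklore] -/
theorem qpoly_coeff_zero (a : ℕ → K) (ha : a 0 = 0) {f : ℕ} (hf : 1 ≤ f) (k : ℕ) :
    (qpoly a f k).coeff 0 = 0 := by
  induction k with
  | zero =>
    rw [qpoly_zero, Polynomial.finsetSum_coeff]
    refine sum_eq_zero fun c _ ↦ ?_
    rw [Polynomial.coeff_C_mul_X_pow]
    split_ifs with h
    · rw [← h, ha]
    · rfl
  | succ k ih =>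
    rw [qpoly_succ' a hf, Polynomial.coeff_sub, ← mul_assoc, Polynomial.coeff_mul_X_zero,
      show ((k + 1 : ℕ) : Polynomial K) * (f : Polynomial K) * Polynomial.X ^ f * qpoly a f k =
        Polynomial.X ^ f * (((k + 1 : ℕ) : Polynomial K) * (f : Polynomial K) * qpoly a f k) by ring,
      Polynomial.coeff_X_pow_mul', if_neg (by omega), sub_zero]

/-- **The coefficient of `Z` in `Q_k` is `(-1)^k a(1)`** (`f ≥ 2`). [folklore] -/
theorem qpoly_coeff_one (a : ℕ → K) {f : ℕ} (hf : 2 ≤ f) (k : ℕ) :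
    (qpoly a f k).coeff 1 = (-1) ^ k * a 1 := by
  induction k with
  | zero =>
    rw [qpoly_zero, Polynomial.finsetSum_coeff, pow_zero, one_mul,
      sum_eq_single_of_mem 1 (mem_range.mpr (by omega))]
    · rw [Polynomial.coeff_C_mul_X_pow, if_pos rfl]
    · intro c _ hc; rw [Polynomial.coeff_C_mul_X_pow, if_neg hc.symm]
  | succ k ih =>
    rw [qpoly_succ' a (by omega), Polynomial.coeff_sub, sub_mul, one_mul, Polynomial.coeff_sub]
    have h1 : (Polynomial.X ^ f * (Polynomial.derivative (qpoly a f k) * Polynomial.X)).coeff 1 = 0 := by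
      rw [Polynomial.coeff_X_pow_mul', if_neg (by omega)]
    have h2 : (Polynomial.derivative (qpoly a f k) * Polynomial.X).coeff 1 = (qpoly a f k).coeff 1 := by
      rw [Polynomial.coeff_mul_X, Polynomial.coeff_derivative, zero_add, Nat.cast_zero, zero_add, mul_one]
    have h3 : (((k + 1 : ℕ) : Polynomial K) * (f : Polynomial K) * Polynomial.X ^ f * qpoly a f k).coeff 1 = 0 := by
      rw [mul_comm _ (Polynomial.X ^ f), mul_assoc, mul_assoc, Polynomial.coeff_X_pow_mul', if_neg (by omega)]
    rw [h1, h2, h3, zero_sub, sub_zero, ih, pow_succ]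
    ring

/-- **Support on units**: if `a(c) = 0` whenever `M ∣ c`, `M ∣ f`, and `ζ₁` satisfies `ζ₁^M = 1` and
`∑_{i<M} ζ₁^{ic} = 0` for `M ∤ c`, then `∑_{i<M} Q_k(ζ₁^i Z) = 0` for all `k`.
[cite: Sinnott1987, (1.17)–(1.18) (support of `α` on `ℤ_pˣ`)] -/
theorem sum_qpoly_comp_eq_zero (a : ℕ → K) {f M : ℕ} (hf : 1 ≤ f) (hMf : M ∣ f)
    (ha : ∀ c, M ∣ c → a c = 0) {ζ₁ : K} (hζ : ζ₁ ^ M = 1)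
    (horth : ∀ c, ¬ M ∣ c → ∑ i ∈ range M, ζ₁ ^ (i * c) = 0) (k : ℕ) :
    ∑ i ∈ range M, (qpoly a f k).comp (Polynomial.C (ζ₁ ^ i) * Polynomial.X) = 0 := by
  have hζf : ∀ i, (ζ₁ ^ i) ^ f = 1 := fun i ↦ by
    obtain ⟨t, ht⟩ := hMf
    rw [← pow_mul, ht, ← mul_assoc, mul_comm i M, mul_assoc, pow_mul, hζ, one_pow]
  have hXf : ∀ i, (Polynomial.C (ζ₁ ^ i) * Polynomial.X : Polynomial K) ^ f = Polynomial.X ^ f :=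
    fun i ↦ by rw [mul_pow, ← Polynomial.C_pow, hζf, Polynomial.C_1, one_mul]
  induction k with
  | zero =>
    simp only [qpoly_zero, Polynomial.sum_comp, Polynomial.mul_comp, Polynomial.C_comp,
      Polynomial.X_pow_comp, mul_pow, ← Polynomial.C_pow, ← mul_assoc, ← Polynomial.C_mul]
    rw [sum_comm]
    refine sum_eq_zero fun c _ ↦ ?_
    rw [← sum_mul, ← map_sum, ← mul_sum]
    by_cases hc : M ∣ c
    · rw [ha c hc, zero_mul, Polynomial.C_0, zero_mul]
    · have : ∑ i ∈ range M, (ζ₁ ^ i) ^ c = 0 := by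
        rw [← horth c hc]; exact sum_congr rfl fun i _ ↦ (pow_mul ζ₁ i c).symm
      rw [this, mul_zero, Polynomial.C_0, zero_mul]
  | succ k ih =>
    have hq : ∀ i, (qpoly a f (k + 1)).comp (Polynomial.C (ζ₁ ^ i) * Polynomial.X) =
        (Polynomial.X ^ f - 1) *
            (Polynomial.derivative ((qpoly a f k).comp (Polynomial.C (ζ₁ ^ i) * Polynomial.X)) *
              Polynomial.X) -
          ((k + 1 : ℕ) : Polynomial K) * (f : Polynomial K) * Polynomial.X ^ f *
            (qpoly a f k).comp (Polynomial.C (ζ₁ ^ i) * Polynomial.X) := by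
      intro i
      simp only [qpoly_succ' a hf, Polynomial.sub_comp, Polynomial.mul_comp, Polynomial.X_pow_comp,
        Polynomial.one_comp, Polynomial.X_comp, hXf, Polynomial.natCast_comp, Polynomial.derivative_comp,
        Polynomial.derivative_mul, Polynomial.derivative_C, Polynomial.derivative_X, zero_mul, zero_add,
        mul_one]
      ring
    simp only [hq]
    rw [sum_sub_distrib, ← mul_sum, ← sum_mul, ← Polynomial.derivative_sum, ← mul_sum, ih,
      Polynomial.derivative_zero, zero_mul, mul_zero, mul_zero, sub_zero]

/-- `reflect 1 X = 1`. [folklore] -/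
theorem reflect_one_X : Polynomial.reflect 1 (Polynomial.X : Polynomial K) = 1 := by
  have h := Polynomial.reflect_monomial (R := K) 1 1
  rwa [pow_one, Polynomial.revAt_le le_rfl, Nat.sub_self, pow_zero] at h

/-- `reflect N (p X) = reflect (N-1) p` for `deg p ≤ N - 1`, `N ≥ 1`. [folklore] -/
theorem reflect_mul_X (p : Polynomial K) {N : ℕ} (hN : 1 ≤ N) (hp : p.natDegree ≤ N - 1) :
    Polynomial.reflect N (p * Polynomial.X) = Polynomial.reflect (N - 1) p := by
  have h := Polynomial.reflect_mul p Polynomial.X hp (Polynomial.natDegree_X_le (R := K))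
  rwa [Nat.sub_add_cancel hN, reflect_one_X, mul_one] at h

/-- **`X (reflect_N p)' = N reflect_N p - reflect_{N-1} p'`** (`deg p ≤ N`, `N ≥ 1`). [folklore] -/
theorem X_mul_derivative_reflect (p : Polynomial K) {N : ℕ} (hN : 1 ≤ N) (hp : p.natDegree ≤ N) :
    Polynomial.X * Polynomial.derivative (Polynomial.reflect N p) =
      (N : Polynomial K) * Polynomial.reflect N p - Polynomial.reflect (N - 1) (Polynomial.derivative p) := by
  ext i
  rw [Polynomial.coeff_sub, ← Polynomial.C_eq_natCast, Polynomial.coeff_C_mul, Polynomial.coeff_reflect,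
    Polynomial.coeff_reflect, Polynomial.coeff_derivative]
  cases i with
  | zero =>
    rw [Polynomial.coeff_X_mul_zero, Polynomial.revAt_le (Nat.zero_le _), Nat.sub_zero,
      Polynomial.revAt_le (Nat.zero_le _), Nat.sub_zero, Nat.sub_add_cancel hN]
    push_cast [Nat.cast_sub hN]
    ring
  | succ j =>
    rw [Polynomial.coeff_X_mul, Polynomial.coeff_derivative, Polynomial.coeff_reflect]
    rcases le_or_gt (j + 1) N with hj | hj
    · rw [Polynomial.revAt_le hj]
      rcases le_or_gt (j + 1) (N - 1) with hj' | hj'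
      · rw [Polynomial.revAt_le hj', show N - 1 - (j + 1) + 1 = N - (j + 1) by omega]
        push_cast [Nat.cast_sub hj, Nat.cast_sub hj']
        have : ((N - 1 : ℕ) : K) = N - 1 := by push_cast [Nat.cast_sub hN]; ring
        rw [this]
        ring
      · have hjN : j + 1 = N := by omega
        subst hjN
        rw [Polynomial.revAt_eq_self_of_lt (by omega), Nat.sub_self,
          Polynomial.coeff_eq_zero_of_natDegree_lt (by omega : p.natDegree < j + 1 + 1)]
        push_cast
        ring
    · rw [Polynomial.revAt_eq_self_of_lt hj, Polynomial.revAt_eq_self_of_lt (by omega),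
        Polynomial.coeff_eq_zero_of_natDegree_lt (by omega : p.natDegree < j + 1),
        Polynomial.coeff_eq_zero_of_natDegree_lt (by omega : p.natDegree < j + 1 + 1)]
      ring

/-- `reflect` of a finite sum. [folklore] -/
theorem reflect_sum {ι : Type*} (s : Finset ι) (g : ι → Polynomial K) (N : ℕ) :
    Polynomial.reflect N (∑ i ∈ s, g i) = ∑ i ∈ s, Polynomial.reflect N (g i) := by
  classical
  induction s using Finset.induction_on with
  | empty => rw [sum_empty, sum_empty, Polynomial.reflect_zero]
  | insert x s hx ih => rw [sum_insert hx, sum_insert hx, Polynomial.reflect_add, ih]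

/-- **Reflection**: if `a(0) = 0` and `a(f - c) = ε a(c)` for `0 < c < f`, then
`Z^{f(k+1)} Q_k(1/Z) = ε Q_k(Z)`, i.e. `reflect (f(k+1)) Q_k = ε Q_k`.
[cite: Sinnott1987, (4.8) (the case `k = 0`: `R(Z) + R(Z⁻¹)`)] -/
theorem reflect_qpoly (a : ℕ → K) {f : ℕ} (hf : 1 ≤ f) (ε : K) (ha0 : a 0 = 0)
    (ha : ∀ c, 0 < c → c < f → a (f - c) = ε * a c) (k : ℕ) :
    Polynomial.reflect (f * (k + 1)) (qpoly a f k) = Polynomial.C ε * qpoly a f k := by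
  induction k with
  | zero =>
    rw [zero_add, mul_one, qpoly_zero, mul_sum, reflect_sum]
    have h1 : ∀ c ∈ range f, Polynomial.reflect f (Polynomial.C (a c) * Polynomial.X ^ c) =
        Polynomial.C (a c) * Polynomial.X ^ (f - c) := fun c hc ↦ by
      rw [Polynomial.reflect_C_mul_X_pow, Polynomial.revAt_le (mem_range.mp hc).le]
    rw [sum_congr rfl h1]
    -- reindex by the involution `c ↦ f - c` on `1, …, f-1` (the terms `c = 0` vanish)
    refine Finset.sum_nbij' (fun c ↦ if c = 0 then 0 else f - c) (fun c ↦ if c = 0 then 0 else f - c)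
      (fun c hc ↦ ?_) (fun c hc ↦ ?_) (fun c hc ↦ ?_) (fun c hc ↦ ?_) (fun c hc ↦ ?_)
    · rw [mem_range] at hc ⊢; split_ifs <;> omega
    · rw [mem_range] at hc ⊢; split_ifs <;> omega
    · rw [mem_range] at hc; split_ifs with h1 h2 <;> omega
    · rw [mem_range] at hc; split_ifs with h1 h2 <;> omega
    · rw [mem_range] at hc
      split_ifs with h0
      · rw [h0, ha0, Polynomial.C_0, zero_mul, zero_mul, mul_zero]
      · have h := ha (f - c) (by omega) (by omega)
        rw [Nat.sub_sub_self hc.le] at h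
        rw [← mul_assoc, ← Polynomial.C_mul, ← h]
  | succ k ih =>
    have hN1 : 1 ≤ f * (k + 1) := Nat.succ_le_of_lt (Nat.mul_pos hf (Nat.succ_pos k))
    have hdeg := natDegree_qpoly_le a hf k
    have hdeg' : (Polynomial.derivative (qpoly a f k)).natDegree ≤ f * (k + 1) - 1 :=
      (Polynomial.natDegree_derivative_le _).trans (Nat.sub_le_sub_right hdeg 1)
    have hXf : (Polynomial.X ^ f - 1 : Polynomial K).natDegree ≤ f :=
      (Polynomial.natDegree_sub_le _ _).trans (max_le (Polynomial.natDegree_X_pow_le f) (by simp))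
    have hQX : (Polynomial.derivative (qpoly a f k) * Polynomial.X).natDegree ≤ f * (k + 1) :=
      Polynomial.natDegree_mul_le.trans (by
        have := Polynomial.natDegree_X_le (R := K); omega)
    have hA : Polynomial.reflect f (Polynomial.X ^ f - 1 : Polynomial K) = 1 - Polynomial.X ^ f := by
      rw [Polynomial.reflect_sub, Polynomial.reflect_monomial, Polynomial.reflect_one,
        Polynomial.revAt_le le_rfl, Nat.sub_self, pow_zero]
    have hB : Polynomial.reflect (f * (k + 1)) (Polynomial.derivative (qpoly a f k) * Polynomial.X) =
        Polynomial.C ε * (((f * (k + 1) : ℕ) : Polynomial K) * qpoly a f k -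
          Polynomial.X * Polynomial.derivative (qpoly a f k)) := by
      rw [reflect_mul_X _ hN1 hdeg']
      have h := X_mul_derivative_reflect (qpoly a f k) hN1 hdeg
      rw [ih, Polynomial.derivative_C_mul] at h
      linear_combination h
    have hC : Polynomial.reflect f (Polynomial.X ^ f : Polynomial K) = 1 := by
      rw [Polynomial.reflect_monomial, Polynomial.revAt_le le_rfl, Nat.sub_self, pow_zero]
    have hsucc : qpoly a f (k + 1) =
        (Polynomial.X ^ f - 1) * (Polynomial.derivative (qpoly a f k) * Polynomial.X) -
          Polynomial.C ((((k + 1) * f : ℕ)) : K) * (Polynomial.X ^ f * qpoly a f k) := by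
      rw [qpoly_succ' a hf, map_natCast]; push_cast; ring
    have hidx : f * (k + 1 + 1) = f + f * (k + 1) := by ring
    rw [hidx, hsucc, Polynomial.reflect_sub, Polynomial.reflect_mul _ _ hXf hQX, hA, hB,
      Polynomial.reflect_C_mul, Polynomial.reflect_mul _ _ (Polynomial.natDegree_X_pow_le f) hdeg, hC, ih,
      map_natCast]
    push_cast
    ring

end QPoly

/-! ### Gauss sums of primitive characters: `g(χ) g̅(χ) = N` -/

section Gauss

variable {K : Type*} [Field K] {N : ℕ} [NeZero N]

/-- **`g(χ, e) · g(χ⁻¹, e⁻¹) = N`** for a primitive Dirichlet character `χ` modulo `N` and a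
primitive additive character `e` of `ℤ/N` (for `e(x) = ζ^x` this is `|g(χ)|² = N`).
[cite: Washington1997, Lemma 4.7] -/
theorem gaussSum_mul_gaussSum_inv_eq_natCast {χ : DirichletCharacter K N} (hχ : χ.IsPrimitive)
    {e : AddChar (ZMod N) K} (he : e.IsPrimitive) :
    gaussSum χ e * gaussSum χ⁻¹ e⁻¹ = N := by
  classical
  calc gaussSum χ e * gaussSum χ⁻¹ e⁻¹
      = ∑ b : ZMod N, e (-b) * (χ⁻¹ b * gaussSum χ e) := by
        rw [gaussSum, gaussSum, mul_sum]
        refine sum_congr rfl fun b _ ↦ ?_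
        rw [AddChar.inv_apply]; ring
    _ = ∑ b : ZMod N, e (-b) * ∑ a : ZMod N, χ a * e (b * a) := by
        refine sum_congr rfl fun b _ ↦ ?_
        rw [← gaussSum_mulShift_of_isPrimitive (e := e) hχ b, gaussSum]
        simp only [AddChar.mulShift_apply]
    _ = ∑ a : ZMod N, χ a * ∑ b : ZMod N, e (b * (a - 1)) := by
        simp only [mul_sum]
        rw [sum_comm]
        refine sum_congr rfl fun a _ ↦ sum_congr rfl fun b _ ↦ ?_
        rw [mul_sub, mul_one, sub_eq_add_neg, AddChar.map_add_eq_mul]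
        ring
    _ = N := by
        have h : ∀ a : ZMod N, ∑ b : ZMod N, e (b * (a - 1)) = if a = 1 then (N : K) else 0 := by
          intro a
          rw [AddChar.sum_mulShift _ he, ZMod.card]
          by_cases ha : a = 1 <;> simp [ha, sub_eq_zero]
        simp_rw [h, mul_ite, mul_zero]
        rw [Finset.sum_ite_eq' univ (1 : ZMod N), if_pos (mem_univ _), map_one, one_mul]

end Gauss

/-! ### Formal calculus in `K⟦t⟧`: `(d/dt)^k [P(c e^t)/((c e^t)^f - 1)]` -/

section Calculus

variable {K : Type*} [CommRing K] [Algebra ℚ K]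

/-- `d/dt (c e^t) = c e^t`. [folklore] -/
theorem derivative_C_mul_exp (c : K) : d⁄dX K (C c * exp K) = C c * exp K := by
  rw [Derivation.leibniz, derivative_C, smul_zero, add_zero, derivative_exp, smul_eq_mul]

/-- Chain rule: `d/dt P(c e^t) = (Z P')(c e^t)`. [folklore] -/
theorem derivative_aeval_C_mul_exp (c : K) (P : Polynomial K) :
    d⁄dX K (Polynomial.aeval (C c * exp K) P) =
      Polynomial.aeval (C c * exp K) (Polynomial.derivative P * Polynomial.X) := by
  rw [Derivation.map_aeval, derivative_C_mul_exp, smul_eq_mul, map_mul, Polynomial.aeval_X]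

/-- **`(d/dt)^k` of `W = Q_0(c e^t)/((c e^t)^f - 1)`**: if `W · V = Q_0(u)` with `u = c e^t`,
`V = u^f - 1`, then `W^{(k)} · V^{k+1} = Q_k(u)`. [folklore] -/
theorem iterate_derivative_mul_pow (c : K) (a : ℕ → K) (f : ℕ) (W : K⟦X⟧)
    (hW : W * Polynomial.aeval (C c * exp K) (Polynomial.X ^ f - 1 : Polynomial K) =
      Polynomial.aeval (C c * exp K) (qpoly a f 0)) (k : ℕ) :
    (d⁄dX K)^[k] W * (Polynomial.aeval (C c * exp K) (Polynomial.X ^ f - 1 : Polynomial K)) ^ (k + 1) =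
      Polynomial.aeval (C c * exp K) (qpoly a f k) := by
  induction k with
  | zero => rw [Function.iterate_zero_apply, zero_add, pow_one, hW]
  | succ k ih =>
    have hD := congrArg (d⁄dX K) ih
    rw [Derivation.leibniz, smul_eq_mul, smul_eq_mul, derivative_pow, derivative_aeval_C_mul_exp,
      derivative_aeval_C_mul_exp, Nat.add_sub_cancel, map_mul, map_mul, Polynomial.aeval_X] at hD
    have hR : Polynomial.aeval (C c * exp K) (qpoly a f (k + 1)) =
        Polynomial.aeval (C c * exp K) (Polynomial.X ^ f - 1 : Polynomial K) *
            (Polynomial.aeval (C c * exp K) (Polynomial.derivative (qpoly a f k)) * (C c * exp K)) -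
          ((k + 1 : ℕ) : K⟦X⟧) * (Polynomial.aeval (C c * exp K) (qpoly a f k) *
            (Polynomial.aeval (C c * exp K) (Polynomial.derivative (Polynomial.X ^ f - 1 : Polynomial K)) *
              (C c * exp K))) := by
      simp only [qpoly_succ, map_sub, map_mul, map_natCast, Polynomial.aeval_X]
    rw [Function.iterate_succ_apply', hR, ← ih]
    linear_combination (Polynomial.aeval (C c * exp K) (Polynomial.X ^ f - 1 : Polynomial K)) * hD

omit [Algebra ℚ K] in
/-- `(d/dt)^k φ |_{t=0} = k! · [t^k] φ`. [folklore] -/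
theorem constantCoeff_iterate_derivative (φ : K⟦X⟧) (k : ℕ) :
    constantCoeff ((d⁄dX K)^[k] φ) = (k.factorial : K) * coeff k φ := by
  induction k generalizing φ with
  | zero => rw [Function.iterate_zero_apply, Nat.factorial_zero, Nat.cast_one, one_mul, coeff_zero_eq_constantCoeff]
  | succ k ih =>
    rw [Function.iterate_succ_apply, ih, coeff_derivative, Nat.factorial_succ]
    push_cast
    ring_nf

omit [Algebra ℚ K] in
/-- `P(u)|_{t=0} = P(u(0))`. [folklore] -/
theorem constantCoeff_aeval (u : K⟦X⟧) (P : Polynomial K) :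
    constantCoeff (Polynomial.aeval u P) = P.eval (constantCoeff u) := by
  rw [Polynomial.aeval_def, Polynomial.eval, Polynomial.hom_eval₂]
  rfl

/-- `(c e^t)|_{t=0} = c`. [folklore] -/
theorem constantCoeff_C_mul_exp (c : K) : constantCoeff (C c * exp K) = c := by
  rw [map_mul, constantCoeff_C, constantCoeff_exp, mul_one]

end Calculus

/-! ### The identity `g(φ) B_{n,λφ̄} = n ∑_b φ(b) Q_{n-1}(ζ^b)/((ζ^b)^f-1)^n` -/

section Identity

variable {K : Type*} [Field K] [CharZero K] {f m₂ : ℕ}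

omit [CharZero K] in
/-- The values of the product character `Λ = λ' φ'` of characters modulo `f` and `m₂`, viewed modulo
`f m₂`: `Λ(c) = λ'(c mod f) φ'(c mod m₂)` for ALL `c` (both sides vanish on non-units). [folklore] -/
theorem changeLevel_mul_changeLevel_apply [NeZero (f * m₂)] (θ : DirichletCharacter K f)
    (φ' : DirichletCharacter K m₂) (c : ZMod (f * m₂)) :
    (DirichletCharacter.changeLevel (dvd_mul_right f m₂) θ *
        DirichletCharacter.changeLevel (dvd_mul_left m₂ f) φ') c =
      θ (c.cast : ZMod f) * φ' (c.cast : ZMod m₂) := by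
  rw [MulChar.mul_apply]
  by_cases hc : IsUnit c
  · obtain ⟨w, rfl⟩ := hc
    rw [DirichletCharacter.changeLevel_eq_cast_of_dvd θ, DirichletCharacter.changeLevel_eq_cast_of_dvd φ']
  · rw [MulChar.map_nonunit _ hc, zero_mul]
    -- some prime `ℓ ∣ c.val` divides `f m₂`, hence `f` or `m₂`
    have hc' : ¬ c.val.Coprime (f * m₂) := by
      rwa [← ZMod.isUnit_iff_coprime, ZMod.natCast_zmod_val]
    obtain ⟨ℓ, hℓ, hℓc, hℓfm⟩ := Nat.Prime.not_coprime_iff_dvd.mp hc'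
    rcases (Nat.Prime.dvd_mul hℓ).mp hℓfm with hℓf | hℓm
    · have : ¬ IsUnit (c.cast : ZMod f) := by
        rw [ZMod.cast_eq_val, ZMod.isUnit_iff_coprime]
        exact fun hcop ↦ hℓ.one_lt.ne' (Nat.eq_one_of_dvd_coprimes hcop hℓc hℓf)
      rw [MulChar.map_nonunit _ this, zero_mul]
    · have : ¬ IsUnit (c.cast : ZMod m₂) := by
        rw [ZMod.cast_eq_val, ZMod.isUnit_iff_coprime]
        exact fun hcop ↦ hℓ.one_lt.ne' (Nat.eq_one_of_dvd_coprimes hcop hℓc hℓm)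
      rw [MulChar.map_nonunit _ this, mul_zero]

/-- A sum over `ℤ/m₂` of a function vanishing off the units is a sum over `(ℤ/m₂)ˣ`. [folklore] -/
theorem sum_univ_eq_sum_units [NeZero m₂] {β : Type*} [AddCommMonoid β] (F : ZMod m₂ → β)
    (hF : ∀ b, ¬ IsUnit b → F b = 0) : ∑ b : ZMod m₂, F b = ∑ b : (ZMod m₂)ˣ, F b := by
  classical
  have h1 : ∑ b : (ZMod m₂)ˣ, F b = ∑ b ∈ (univ : Finset (ZMod m₂)ˣ).map ⟨Units.val, Units.val_injective⟩, F b := by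
    rw [sum_map]; rfl
  have h2 : (univ : Finset (ZMod m₂)ˣ).map ⟨Units.val, Units.val_injective⟩ = univ.filter IsUnit := by
    ext b
    simp only [mem_map, mem_univ, true_and, Function.Embedding.coeFn_mk, mem_filter]
    exact ⟨fun ⟨w, hw⟩ ↦ hw ▸ w.isUnit, fun ⟨w, hw⟩ ↦ ⟨w, hw⟩⟩
  rw [h1, h2, sum_filter_of_ne]
  exact fun b _ hb ↦ by_contra fun hu ↦ hb (hF b hu)

omit [CharZero K] in
/-- Block decomposition `∑_{v < f e} F(v) = ∑_{i<e} ∑_{c<f} F(f i + c)`. [folklore] -/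
theorem sum_range_mul_eq_sum_blocks_qpoly {β : Type*} [AddCommMonoid β] (F : ℕ → β) (e : ℕ) :
    ∑ v ∈ range (f * e), F v = ∑ i ∈ range e, ∑ c ∈ range f, F (f * i + c) := by
  induction e with
  | zero => rw [mul_zero, sum_range_zero, sum_range_zero]
  | succ e ih => rw [Nat.mul_succ, sum_range_add, ih, sum_range_succ]

/-- **Periodicity**: with `u = z e^t`, `z^{m₂} = 1`,
`(∑_{v < f m₂} λ'(v) z^v e^{vt}) · (u^f - 1) = Q_0(u) · (e^{f m₂ t} - 1)`. [folklore] -/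
theorem periodicSum_mul (θ : DirichletCharacter K f) {z : K} (hz : z ^ m₂ = 1) :
    (∑ v ∈ range (f * m₂), C (θ (v : ZMod f) * z ^ v) * rescale (v : K) (exp K)) *
        Polynomial.aeval (C z * exp K) (Polynomial.X ^ f - 1 : Polynomial K) =
      Polynomial.aeval (C z * exp K) (qpoly (fun c ↦ θ (c : ZMod f)) f 0) *
        (rescale ((f * m₂ : ℕ) : K) (exp K) - 1) := by
  -- `u^c = z^c e^{ct}`
  have hu : ∀ c : ℕ, (C z * exp K) ^ c = C (z ^ c) * rescale (c : K) (exp K) := fun c ↦ by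
    rw [mul_pow, ← map_pow, exp_pow_eq_rescale_exp]
  set Y : K⟦X⟧ := C (z ^ f) * rescale (f : K) (exp K) with hY
  have hA : Polynomial.aeval (C z * exp K) (qpoly (fun c ↦ θ (c : ZMod f)) f 0) =
      ∑ c ∈ range f, C (θ (c : ZMod f) * z ^ c) * rescale (c : K) (exp K) := by
    rw [qpoly_zero, map_sum]
    refine sum_congr rfl fun c _ ↦ ?_
    rw [map_mul, Polynomial.aeval_C, ← C_eq_algebraMap, map_pow, Polynomial.aeval_X, hu, ← mul_assoc,
      ← map_mul]
  have hV : Polynomial.aeval (C z * exp K) (Polynomial.X ^ f - 1 : Polynomial K) = Y - 1 := by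
    rw [map_sub, map_pow, Polynomial.aeval_X, map_one, hu]
  have hF : ∀ i c : ℕ, C (θ ((f * i + c : ℕ) : ZMod f) * z ^ (f * i + c)) *
      rescale ((f * i + c : ℕ) : K) (exp K) =
        (C (θ (c : ZMod f) * z ^ c) * rescale (c : K) (exp K)) * Y ^ i := by
    intro i c
    have h1 : ((f * i + c : ℕ) : ZMod f) = (c : ZMod f) := by
      push_cast; rw [ZMod.natCast_self, zero_mul, zero_add]
    have h2 : rescale ((f * i + c : ℕ) : K) (exp K) =
        (rescale (f : K) (exp K)) ^ i * rescale (c : K) (exp K) := by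
      rw [← exp_pow_eq_rescale_exp, ← exp_pow_eq_rescale_exp, ← exp_pow_eq_rescale_exp, ← pow_mul,
        ← pow_add]
    rw [h1, h2, hY, mul_pow, ← map_pow C (z ^ f) i, pow_add, pow_mul, map_mul, map_mul, map_mul]
    ring
  have hsum : ∑ v ∈ range (f * m₂), C (θ (v : ZMod f) * z ^ v) * rescale (v : K) (exp K) =
      (∑ c ∈ range f, C (θ (c : ZMod f) * z ^ c) * rescale (c : K) (exp K)) * ∑ i ∈ range m₂, Y ^ i := by
    rw [sum_range_mul_eq_sum_blocks_qpoly, mul_sum]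
    refine sum_congr rfl fun i _ ↦ ?_
    rw [sum_mul]
    exact sum_congr rfl fun c _ ↦ hF i c
  have hYm : Y ^ m₂ = rescale ((f * m₂ : ℕ) : K) (exp K) := by
    rw [hY, mul_pow, ← map_pow, ← pow_mul, pow_mul', hz, one_pow, map_one, one_mul,
      ← exp_pow_eq_rescale_exp, ← pow_mul, exp_pow_eq_rescale_exp]
  rw [hsum, hV, hA, mul_assoc, geom_sum_mul, hYm]

/-- `u_b = ζ^b e^t ∈ K⟦t⟧` for a unit `b` modulo `m₂`. [folklore] -/
def unitExp (ζ : K) (b : (ZMod m₂)ˣ) : K⟦X⟧ := C (ζ ^ (b : ZMod m₂).val) * exp K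

/-- `V_b = u_b^f - 1`. [folklore] -/
def vSer (f : ℕ) (ζ : K) (b : (ZMod m₂)ˣ) : K⟦X⟧ :=
  Polynomial.aeval (unitExp ζ b) (Polynomial.X ^ f - 1 : Polynomial K)

/-- `A_b = Q_0(u_b)`. [folklore] -/
def aSer (θ : DirichletCharacter K f) (ζ : K) (b : (ZMod m₂)ˣ) : K⟦X⟧ :=
  Polynomial.aeval (unitExp ζ b) (qpoly (fun c ↦ θ (c : ZMod f)) f 0)

/-- `W_b = Q_0(u_b) / (u_b^f - 1) = R(ζ^b e^t)` (`R = Q_0/(Z^f - 1)`). [cite: Sinnott1987, Prop. 4.6] -/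
def wSer (θ : DirichletCharacter K f) (ζ : K) (b : (ZMod m₂)ˣ) : K⟦X⟧ :=
  aSer θ ζ b * (vSer f ζ b)⁻¹

/-- `V_b(0) = (ζ^b)^f - 1`. [folklore] -/
theorem constantCoeff_vSer (ζ : K) (b : (ZMod m₂)ˣ) :
    constantCoeff (vSer f ζ b) = (ζ ^ (b : ZMod m₂).val) ^ f - 1 := by
  rw [vSer, constantCoeff_aeval, unitExp, constantCoeff_C_mul_exp, Polynomial.eval_sub,
    Polynomial.eval_pow, Polynomial.eval_X, Polynomial.eval_one]

/-- `W_b V_b = A_b`. [folklore] -/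
theorem wSer_mul_vSer (θ : DirichletCharacter K f) {ζ : K} {b : (ZMod m₂)ˣ}
    (h : (ζ ^ (b : ZMod m₂).val) ^ f - 1 ≠ 0) : wSer θ ζ b * vSer f ζ b = aSer θ ζ b := by
  rw [wSer, mul_assoc, PowerSeries.inv_mul_cancel _ (by rw [constantCoeff_vSer]; exact h), mul_one]

omit [CharZero K] in
/-- For a unit `b` modulo `m₂` and `c` modulo `m₂`: `ζ^{(c b)} = (ζ^b)^{c}` (`ζ^{m₂} = 1`). [folklore] -/
theorem pow_val_mul {ζ : K} (hζ : ζ ^ m₂ = 1) (v : ℕ) (b : (ZMod m₂)ˣ) :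
    ζ ^ (((v : ZMod m₂)) * (b : ZMod m₂)).val = (ζ ^ (b : ZMod m₂).val) ^ v := by
  rw [ZMod.val_mul, ZMod.val_natCast, ← pow_eq_pow_mod _ hζ, pow_mul, ← pow_eq_pow_mod _ hζ,
    ← pow_mul, mul_comm, pow_mul]

/-- **The unit sum**: `∑_{c mod f m₂} λ'(c) ζ^{bc} e^{ct} = W_b · (e^{f m₂ t} - 1)`.
[cite: Sinnott1987, proof of Prop. 4.6] -/
theorem unitSum_eq [NeZero (f * m₂)] (θ : DirichletCharacter K f) {ζ : K} (hζ : ζ ^ m₂ = 1)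
    (b : (ZMod m₂)ˣ) (h : (ζ ^ (b : ZMod m₂).val) ^ f - 1 ≠ 0) :
    ∑ c : ZMod (f * m₂), C (θ (c.cast : ZMod f) * ζ ^ ((c.cast : ZMod m₂) * (b : ZMod m₂)).val) *
        rescale (c.val : K) (exp K) =
      wSer θ ζ b * (rescale ((f * m₂ : ℕ) : K) (exp K) - 1) := by
  have h1 : ∑ c : ZMod (f * m₂), C (θ (c.cast : ZMod f) * ζ ^ ((c.cast : ZMod m₂) * (b : ZMod m₂)).val) *
      rescale (c.val : K) (exp K) =
        ∑ v ∈ range (f * m₂), C (θ (v : ZMod f) * (ζ ^ (b : ZMod m₂).val) ^ v) * rescale (v : K) (exp K) := by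
    refine Finset.sum_nbij (fun c ↦ c.val) (fun c _ ↦ mem_range.mpr (ZMod.val_lt c))
      (fun x _ y _ hxy ↦ ZMod.val_injective _ hxy) (fun v hv ↦ ?_) (fun c _ ↦ ?_)
    · rw [Finset.mem_coe, mem_range] at hv
      exact ⟨(v : ZMod (f * m₂)), Finset.mem_coe.mpr (mem_univ _), ZMod.val_natCast_of_lt hv⟩
    · rw [ZMod.cast_eq_val, ZMod.cast_eq_val, pow_val_mul hζ]
  have hzm : (ζ ^ (b : ZMod m₂).val) ^ m₂ = 1 := by rw [← pow_mul, mul_comm, pow_mul, hζ, one_pow]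
  have hP := periodicSum_mul θ hzm
  rw [h1]
  calc ∑ v ∈ range (f * m₂), C (θ (v : ZMod f) * (ζ ^ (b : ZMod m₂).val) ^ v) * rescale (v : K) (exp K)
      = (∑ v ∈ range (f * m₂), C (θ (v : ZMod f) * (ζ ^ (b : ZMod m₂).val) ^ v) *
          rescale (v : K) (exp K)) * vSer f ζ b * (vSer f ζ b)⁻¹ := by
        rw [mul_assoc, PowerSeries.mul_inv_cancel _ (by rw [constantCoeff_vSer]; exact h), mul_one]
    _ = aSer θ ζ b * (rescale ((f * m₂ : ℕ) : K) (exp K) - 1) * (vSer f ζ b)⁻¹ := by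
        rw [vSer, unitExp, hP, aSer, unitExp]
    _ = wSer θ ζ b * (rescale ((f * m₂ : ℕ) : K) (exp K) - 1) := by rw [wSer]; ring

/-- **`(d/dt)^k W_b |_{t=0} = Q_k(ζ^b) / ((ζ^b)^f - 1)^{k+1}`**. [folklore] -/
theorem constantCoeff_iterate_derivative_wSer (θ : DirichletCharacter K f) {ζ : K} {b : (ZMod m₂)ˣ}
    (h : (ζ ^ (b : ZMod m₂).val) ^ f - 1 ≠ 0) (k : ℕ) :
    constantCoeff ((d⁄dX K)^[k] (wSer θ ζ b)) =
      (qpoly (fun c ↦ θ (c : ZMod f)) f k).eval (ζ ^ (b : ZMod m₂).val) /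
        ((ζ ^ (b : ZMod m₂).val) ^ f - 1) ^ (k + 1) := by
  have hmain := iterate_derivative_mul_pow (ζ ^ (b : ZMod m₂).val) (fun c ↦ θ (c : ZMod f)) f
    (wSer θ ζ b) (wSer_mul_vSer θ h) k
  have hcc := congrArg constantCoeff hmain
  rw [map_mul, map_pow, constantCoeff_aeval, constantCoeff_aeval, constantCoeff_C_mul_exp,
    Polynomial.eval_sub, Polynomial.eval_pow, Polynomial.eval_X, Polynomial.eval_one] at hcc
  rw [eq_div_iff (pow_ne_zero _ h), hcc]

/-- **Bernoulli numbers as Γ-transforms** (Sinnott's Proposition 4.6 / (4.2) for all `n ≥ 1`).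
Let `λ'` be a Dirichlet character modulo `f`, `φ` a primitive Dirichlet character modulo `m₂ ∤ f`,
`ζ` a primitive `m₂`-th root of unity, `g(φ) = ∑_a φ(a) ζ^a`, and `Λ = λ' φ̄` modulo `f m₂`.  Then
`g(φ) · B_{n,Λ} = n · ∑_{b ∈ (ℤ/m₂)ˣ} φ(b) Q_{n-1}(ζ^b) / ((ζ^b)^f - 1)^n`.
[cite: Sinnott1987, Prop. 4.6 and (4.2) (`n = 1`); DiamondShurman2005, §4.7 (4.29)] -/
theorem gaussSum_mul_generalizedBernoulli [NeZero m₂] [NeZero (f * m₂)] (θ : DirichletCharacter K f)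
    {φ : DirichletCharacter K m₂} (hφ : φ.IsPrimitive) {ζ : K} (hζ : IsPrimitiveRoot ζ m₂)
    (hf : ¬ m₂ ∣ f) {n : ℕ} (hn : 1 ≤ n) :
    gaussSum φ (AddChar.zmodChar m₂ hζ.pow_eq_one) *
        generalizedBernoulli n (DirichletCharacter.changeLevel (dvd_mul_right f m₂) θ *
          DirichletCharacter.changeLevel (dvd_mul_left m₂ f) φ⁻¹) =
      n * ∑ b : (ZMod m₂)ˣ, φ b *
        ((qpoly (fun c ↦ θ (c : ZMod f)) f (n - 1)).eval (ζ ^ (b : ZMod m₂).val) /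
          ((ζ ^ (b : ZMod m₂).val) ^ f - 1) ^ n) := by
  classical
  obtain ⟨k, rfl⟩ : ∃ k, n = k + 1 := ⟨n - 1, by omega⟩
  rw [Nat.add_sub_cancel]
  set e := AddChar.zmodChar m₂ hζ.pow_eq_one with he
  set Λ := DirichletCharacter.changeLevel (dvd_mul_right f m₂) θ *
    DirichletCharacter.changeLevel (dvd_mul_left m₂ f) φ⁻¹ with hΛ
  -- `(ζ^b)^f ≠ 1` for units `b`
  have hzbf : ∀ b : (ZMod m₂)ˣ, (ζ ^ (b : ZMod m₂).val) ^ f - 1 ≠ 0 := by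
    intro b hb
    rw [sub_eq_zero, ← pow_mul, hζ.pow_eq_one_iff_dvd] at hb
    have hcop : ((b : ZMod m₂).val).Coprime m₂ := by
      rw [← ZMod.isUnit_iff_coprime, ZMod.natCast_zmod_val]; exact b.isUnit
    exact hf (hcop.symm.dvd_of_dvd_mul_left hb)
  -- Gauss-sum inversion
  have hinv : ∀ a : ZMod m₂, φ⁻¹ a * gaussSum φ e =
      ∑ b : (ZMod m₂)ˣ, φ b * ζ ^ (a * (b : ZMod m₂)).val := by
    intro a
    rw [← gaussSum_mulShift_of_isPrimitive (e := e) hφ a, gaussSum,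
      sum_univ_eq_sum_units _ (fun b hb ↦ by rw [MulChar.map_nonunit _ hb, zero_mul])]
    refine sum_congr rfl fun b _ ↦ ?_
    rw [AddChar.mulShift_apply, he, AddChar.zmodChar_apply]
  -- the generating-function identity multiplied by `g(φ)`
  have hGF := genBernoulliSeries_mul_exp_sub_one Λ
  have step1 : C (gaussSum φ e) * (genBernoulliSeries Λ * (rescale ((f * m₂ : ℕ) : K) (exp K) - 1)) =
      ∑ c : ZMod (f * m₂), ∑ b : (ZMod m₂)ˣ, C (φ b) * (X *
        (C (θ (c.cast : ZMod f) * ζ ^ ((c.cast : ZMod m₂) * (b : ZMod m₂)).val) *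
          rescale (c.val : K) (exp K))) := by
    rw [hGF, mul_sum]
    refine sum_congr rfl fun c _ ↦ ?_
    rw [← mul_assoc, ← map_mul, mul_comm (gaussSum φ e), hΛ, changeLevel_mul_changeLevel_apply,
      mul_assoc, hinv, mul_sum, map_sum, sum_mul]
    refine sum_congr rfl fun b _ ↦ ?_
    rw [map_mul, map_mul, map_mul]
    ring
  have step2 : C (gaussSum φ e) * (genBernoulliSeries Λ * (rescale ((f * m₂ : ℕ) : K) (exp K) - 1)) =
      (X * ∑ b : (ZMod m₂)ˣ, C (φ b) * wSer θ ζ b) * (rescale ((f * m₂ : ℕ) : K) (exp K) - 1) := by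
    rw [step1, sum_comm, mul_sum, sum_mul]
    refine sum_congr rfl fun b _ ↦ ?_
    rw [← mul_sum, ← mul_sum, unitSum_eq θ hζ.pow_eq_one b (hzbf b)]
    ring
  -- cancel `e^{f m₂ t} - 1`
  have hE0 : rescale ((f * m₂ : ℕ) : K) (exp K) - 1 ≠ 0 := by
    intro h0
    have := congrArg (coeff 1) h0
    rw [map_sub, coeff_rescale, coeff_exp, pow_one, Nat.factorial_one, Nat.cast_one, div_one, map_one,
      mul_one, coeff_one, if_neg one_ne_zero, sub_zero, map_zero] at this
    exact (Nat.cast_ne_zero.mpr (NeZero.ne (f * m₂))) this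
  have hPS : C (gaussSum φ e) * genBernoulliSeries Λ = X * ∑ b : (ZMod m₂)ˣ, C (φ b) * wSer θ ζ b :=
    mul_right_cancel₀ hE0 (by rw [mul_assoc, step2])
  -- compare the coefficients of `t^{k+1}`
  have hk := congrArg (coeff (k + 1)) hPS
  rw [coeff_C_mul, coeff_genBernoulliSeries, coeff_succ_X_mul, map_sum] at hk
  simp_rw [coeff_C_mul] at hk
  have hkfac : (k.factorial : K) ≠ 0 := Nat.cast_ne_zero.mpr k.factorial_ne_zero
  have hk1fac : ((k + 1).factorial : K) ≠ 0 := Nat.cast_ne_zero.mpr (k + 1).factorial_ne_zero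
  have hcoef : ∀ b : (ZMod m₂)ˣ, coeff k (wSer θ ζ b) = ((k.factorial : K))⁻¹ *
      ((qpoly (fun c ↦ θ (c : ZMod f)) f k).eval (ζ ^ (b : ZMod m₂).val) /
        ((ζ ^ (b : ZMod m₂).val) ^ f - 1) ^ (k + 1)) := by
    intro b
    rw [← constantCoeff_iterate_derivative_wSer θ (hzbf b) k, constantCoeff_iterate_derivative,
      ← mul_assoc, inv_mul_cancel₀ hkfac, one_mul]
  simp_rw [hcoef] at hk
  rw [one_div, map_inv₀, map_natCast] at hk
  have hfac : ((k + 1).factorial : K) = (k + 1 : ℕ) * k.factorial := by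
    rw [Nat.factorial_succ, Nat.cast_mul]
  calc gaussSum φ e * generalizedBernoulli (k + 1) Λ
      = ((k + 1).factorial : K) * (gaussSum φ e *
          ((((k + 1).factorial : K))⁻¹ * generalizedBernoulli (k + 1) Λ)) := by
        field_simp
    _ = ((k + 1).factorial : K) * ∑ b : (ZMod m₂)ˣ, φ b * (((k.factorial : K))⁻¹ *
          ((qpoly (fun c ↦ θ (c : ZMod f)) f k).eval (ζ ^ (b : ZMod m₂).val) /
            ((ζ ^ (b : ZMod m₂).val) ^ f - 1) ^ (k + 1))) := by rw [hk]
    _ = ((k + 1 : ℕ) : K) * ∑ b : (ZMod m₂)ˣ, φ b *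
          ((qpoly (fun c ↦ θ (c : ZMod f)) f k).eval (ζ ^ (b : ZMod m₂).val) /
            ((ζ ^ (b : ZMod m₂).val) ^ f - 1) ^ (k + 1)) := by
        rw [hfac, mul_assoc, mul_sum, mul_sum, mul_sum]
        refine sum_congr rfl fun b _ ↦ ?_
        field_simp

end Identity

end Literature.NumberTheory.LFunctions
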